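import Summits.HubbardSuperconductivity.HubbardSuperconductivity.Theses.ThermalWedge

/-!
# Route `ThermalWedge`, item `stmt-HubbardSuperconductivity-1707`: the assembly

`Assembly : TwSeededRung → TwTipContinuation → HubbardSuperconductivity` is pure logic.
`TwTipContinuation` delivers a coupling ceiling `U₁` and a doping `δ ∈ [1/10, 2/5]` at which seeded
`d`-wave order down to seeds `g = K·U` (for every `K > 0` with `K·U ≤ 1/20`) forces the summit's
conclusion for `hubbardTorus 2 L 1 U`; `TwSeededRung` delivers, at that `δ`, a ceiling `U₀` and a
`K > 0` with `K·U₀ ≤ 1/20` and exactly that seeded order for every `0 < U ≤ U₀`.  With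
`U := min U₀ U₁` both apply, `K·U ≤ K·U₀ ≤ 1/20`, and `[1/10, 2/5] ⊂ (0, 1/2)` supplies the summit's
doping window.  (Same term as the route's deciding theorem `ThermalWedge.closes`; kept
self-contained so that this file does not depend on the rendering of the Theses file.)

**Repair 2026-08-16.** `Assembly_proof` proved the CURRIED assembly above (item
stmt-HubbardSuperconductivity-1707, closed `proved` by it). The route repair of 2026-08-15T22:48Z
restated the item UNDER THE SAME DECL NAME `Assembly` in uncurried frame form
`TwSeededRung ∧ TwTipContinuation → HubbardSuperconductivity` (stmt-HubbardSuperconductivity-13891,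
closed by the cycle-free `Theorems.thermalWedge_assembly_structural`, which the route file imports),
so `intro hR hT` stopped elaborating ("introN failed", full builds of 2026-08-16). The theorem keeps
its name and statement text (Theorems files are append-only) and now proves the current `Assembly`
by the same argument, uncurried (`rintro ⟨hR, hT⟩`) — a second, dependent proof of stmt-13891 that
must NOT serve as its `Assembly_holds` link (this module imports the route module; see the warning
in the route file's `Assembly` docstring).
-/

namespace Summit.HubbardSuperconductivity.HubbardSuperconductivity.Theorems

open Summit.HubbardSuperconductivity.HubbardSuperconductivity.Theses.ThermalWedge

/-- **Assembly of route `ThermalWedge`** (originally the curried item `stmt-HubbardSuperconductivity-1707`,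
closed by this theorem; since the same-name restate it proves the uncurried frame,
stmt-HubbardSuperconductivity-13891 — see the module docstring): the seeded
rung `TwSeededRung` and the tip continuation `TwTipContinuation` together imply the summit statement
`HubbardSuperconductivity` (weak-coupling `d_{x²-y²}` pair-field long-range order of the doped 2D
Hubbard torus ground states).  Pure logic: `U := min U₀ U₁`, `δ` from the tip,
`K·U ≤ K·U₀ ≤ 1/20`, `[1/10,2/5] ⊂ (0,1/2)`. [folklore] -/
theorem Assembly_proof :
    Summit.HubbardSuperconductivity.HubbardSuperconductivity.Theses.ThermalWedge.Assembly := by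
  unfold Summit.HubbardSuperconductivity.HubbardSuperconductivity.Theses.ThermalWedge.Assembly
  -- rev ≥ 2026-08-15T22:48Z: `Assembly` is the uncurried frame `TwSeededRung ∧ TwTipContinuation → …`
  rintro ⟨hR, hT⟩
  obtain ⟨U₁, hU₁, δ, hδ, hTip⟩ := hT
  obtain ⟨U₀, K, hU₀, hK, hKU₀, hRung⟩ := hR δ hδ
  have hUpos : 0 < min U₀ U₁ := lt_min hU₀ hU₁
  have hU₀mem : min U₀ U₁ ∈ Set.Ioc (0 : ℝ) U₀ := ⟨hUpos, min_le_left _ _⟩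
  have hU₁mem : min U₀ U₁ ∈ Set.Ioc (0 : ℝ) U₁ := ⟨hUpos, min_le_right _ _⟩
  have hKU : K * min U₀ U₁ ≤ 1 / 20 :=
    le_trans (mul_le_mul_of_nonneg_left (min_le_left _ _) hK.le) hKU₀
  have hδ' : δ ∈ Set.Ioo (0 : ℝ) (1 / 2) := by
    obtain ⟨h₁, h₂⟩ := hδ
    constructor <;> linarith
  exact ⟨min U₀ U₁, hUpos, δ, hδ', fun N ψ hyp =>
    hTip (min U₀ U₁) hU₁mem K hK hKU (hRung (min U₀ U₁) hU₀mem) N ψ hyp⟩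

end Summit.HubbardSuperconductivity.HubbardSuperconductivity.Theorems
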